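import Mathlib
import Literature.Barriers.MatrixMultiplication.NormalizerBarrier
import Literature.RepresentationTheory.FiniteGroups.IrreducibleCharacters
import Literature.RepresentationTheory.FiniteGroups.InducedClassFunction
import Summits.MatrixMultiplication.MatrixMultiplication.Theorems.LieRankDesigns.Negative.Basics
import Summits.MatrixMultiplication.MatrixMultiplication.Theorems.SubgroupIdentityDesigns.Negative.PrincipalSeriesBudget
import Summits.MatrixMultiplication.MatrixMultiplication.Theorems.SubgroupIdentityDesigns.Negative.FlagCharacter
import Summits.MatrixMultiplication.MatrixMultiplication.Theorems.SubgroupIdentityDesigns.Negative.FlagDegree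
import Summits.MatrixMultiplication.MatrixMultiplication.Theorems.SubgroupIdentityDesigns.Negative.FlagNoGo
import Summits.MatrixMultiplication.MatrixMultiplication.Theorems.SubgroupIdentityDesigns.Negative.FlagTwist
import Summits.MatrixMultiplication.MatrixMultiplication.Theorems.SubgroupIdentityDesigns.Negative.FlagTwistNorm

/-!
# General-`k` block-slice no-go for ALL `l ≥ 3` when `p ≥ k + 2`

Supports stmt-MatrixMultiplication-14079 (crux `SubgroupIdentityDesigns`, route
    `LevelGradedCohnUmans`;
BLOCK-SLICES §2).  VALUE = theorem, NOT summit progress.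

For `p ≥ k + 2` the field `𝔽_p` has `k` distinct non-trivial multiplicative characters
`χ_1, …, χ_k` (`exists_chars`, from `|MulChar 𝔽_p| = p - 1`), and the twisted flag character
`Ψ_χ = Ind_{P'}^G(χ_1 ⊗ ⋯ ⊗ χ_k ⊗ 1)` is an IRREDUCIBLE character of `GL_{k+l}(𝔽_p)`
(`FlagTwistNorm.classInner_twChar`) of level `≤ k` (`FlagTwist.twChar_mem_levelSet`) and degree
`[G : P'] ≥ p^{kl + k(k-1)/2}` (`twChar_one_ge`).  Feeding it (norm `c = 1`) into
`FlagNoGo.not_budget_lt_of_char_translate` gives the threshold `p^{3k²+5kl} ≤ p^{6kl+3k²-3k}`,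
i.e. `l ≥ 3` (`threshold_three`), whence:
* **`no_translate_witness`** / `no_slice_witness` / `no_slice_witness'` — for `k ≥ 1`, `l ≥ 3`
  (`m ≥ k + 3`), `p ≥ k + 2`, every `ε > 0` and every subgroup-TPP triple of `GL_{k+l}(𝔽_p)` with
  products in a translate `x S_{k+l,k} y` of the block slice, the crux inequality FAILS.
Together with `FlagNoGo` (all `p`, `l ≥ 3 + 6⌈log₂(k+1)⌉`) and `FlagWindow` (`(k+1)⁶ ≤ p^{l-3}`),
the block-slice line at `l ≥ 3` survives only for the finitely many primes `p ≤ k + 1` per `k`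
in the window `3 ≤ l < 3 + 6⌈log₂(k+1)⌉`.
-/

set_option linter.dupNamespace false

noncomputable section

open scoped BigOperators Matrix Classical
open Literature.Barriers.MatrixMultiplication (SubgroupTPP)
open Literature.RepresentationTheory.FiniteGroups
open Summit.MatrixMultiplication.MatrixMultiplication.Theorems.LieRankDesigns.Negative

namespace Summit.MatrixMultiplication.MatrixMultiplication.Theorems.SubgroupIdentityDesigns.Negative
namespace FlagTwistNoGo

open FlagCharacter (flagStab)
open FlagDegree (card_quotient_flagStab_ge two_mul_sum_range)
open FlagNoGo (not_budget_lt_of_char_translate)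
open FlagTwist (twChar isCharacter_twChar twChar_one twChar_mem_levelSet)
open FlagTwistNorm (classInner_twChar)
open PrincipalSeriesBudget (card_mulChar)

variable {p : ℕ} [hp : Fact p.Prime] {k l : ℕ}

/-- **For `p ≥ k + 2` there are `k` distinct non-trivial multiplicative characters of `𝔽_p`.** -/
theorem exists_chars (hpk : k + 2 ≤ p) :
    ∃ χ : Fin k → MulChar (ZMod p) ℂ, Function.Injective χ ∧ ∀ i, χ i ≠ 1 := by
  letI : Fintype (MulChar (ZMod p) ℂ) := Fintype.ofFinite _
  have hc : Fintype.card (MulChar (ZMod p) ℂ) = p - 1 := by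
    rw [← Nat.card_eq_fintype_card, card_mulChar]
  have hcard : k ≤ Fintype.card {χ : MulChar (ZMod p) ℂ // ¬ χ = 1} := by
    rw [Fintype.card_subtype_compl, Fintype.card_subtype_eq, hc]
    omega
  obtain ⟨e⟩ : Nonempty (Fin k ↪ {χ : MulChar (ZMod p) ℂ // ¬ χ = 1}) :=
    Function.Embedding.nonempty_iff_card_le.mpr (by rwa [Fintype.card_fin])
  exact ⟨fun i => (e i).1, Subtype.val_injective.comp e.injective, fun i => (e i).2⟩

/-- `Ψ_χ(1) ≠ 0`. -/
theorem twChar_one_ne_zero (χ : Fin k → MulChar (ZMod p) ℂ) : twChar (l := l) χ 1 ≠ 0 := by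
  rw [twChar_one]
  exact Nat.cast_ne_zero.mpr Fintype.card_ne_zero

/-- **`(Ψ_χ 1).re ≥ p^{kl} · p^{∑_{i<k} i}`.** -/
theorem twChar_one_ge (χ : Fin k → MulChar (ZMod p) ℂ) :
    ((p ^ (k * l) * p ^ (∑ i ∈ Finset.range k, i) : ℕ) : ℝ) ≤ (twChar (l := l) χ 1).re := by
  rw [twChar_one]
  simp only [Complex.natCast_re, Nat.cast_le]
  have h := card_quotient_flagStab_ge (F := ZMod p) (k := k) (l := l)
  rwa [ZMod.card] at h

omit hp in
/-- The exponent inequality `3k² + 5kl ≤ 6(kl + ∑_{i<k} i)` for `l ≥ 3`. -/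
theorem exp_le (hl : 3 ≤ l) : 3 * (k * k) + 5 * k * l ≤ (k * l + ∑ i ∈ Finset.range k, i) * 6 := by
  have h2e : 2 * (∑ i ∈ Finset.range k, i) = k * (k - 1) := two_mul_sum_range k
  rcases Nat.eq_zero_or_pos k with rfl | hk
  · simp
  · obtain ⟨k, rfl⟩ : ∃ k', k = k' + 1 := ⟨k - 1, by omega⟩
    rw [Nat.add_sub_cancel] at h2e
    have h3 : (k + 1) * 3 ≤ (k + 1) * l := Nat.mul_le_mul_left _ hl
    nlinarith [h2e, h3]

/-- **Threshold at norm `1`**: `l ≥ 3` gives `1⁶ · p^{3k²+5kl} ≤ (p^{kl} p^{∑_{i<k} i})⁶`. -/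
theorem threshold_three (hl : 3 ≤ l) :
    (1 : ℝ) ^ 6 * (p : ℝ) ^ (3 * (k * k) + 5 * k * l) ≤
      (((p ^ (k * l) * p ^ (∑ i ∈ Finset.range k, i) : ℕ) : ℝ)) ^ 6 := by
  rw [one_pow, one_mul]
  have h : p ^ (3 * (k * k) + 5 * k * l) ≤ (p ^ (k * l) * p ^ (∑ i ∈ Finset.range k, i)) ^ 6 := by
    rw [← pow_add, ← pow_mul]
    exact Nat.pow_le_pow_right hp.out.pos (exp_le hl)
  exact_mod_cast h

/-- **General-`k` block-slice no-go for all `l ≥ 3` and `p ≥ k + 2`**: for every `ε > 0`, no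
subgroup-TPP triple of `GL_{k+l}(𝔽_p)` with products in a translate `x S_{k+l,k} y` of the block
slice satisfies the budget inequality of the crux `SubgroupIdentityDesigns`. -/
theorem no_translate_witness (hk : 1 ≤ k) (hl : 3 ≤ l) (hpk : k + 2 ≤ p)
    {H₁ H₂ H₃ : Subgroup (GLm p (k + l))} (htpp : SubgroupTPP H₁ H₂ H₃) (x y : GLm p (k + l))
    (hS : ∀ a ∈ H₁, ∀ b ∈ H₂, ∀ c ∈ H₃, ∀ i j : Fin l,
      ((x⁻¹ * (a * b * c) * y⁻¹ : GLm p (k + l)) : Mat p (k + l)) (Fin.natAdd k i)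
          (Fin.natAdd k j) = (1 : Matrix (Fin l) (Fin l) (ZMod p)) i j)
    {ε : ℝ} (hε : 0 < ε) :
    ¬ ((∑ᶠ ψ ∈ irrChars (GLm p (k + l)) ∩ levelSet p (k + l) k, (ψ 1).re ^ (2 + ε)) <
        ((Nat.card H₁ * Nat.card H₂ * Nat.card H₃ : ℕ) : ℝ) ^ ((2 + ε) / 3)) := by
  obtain ⟨χ, hχ, hχ1⟩ := exists_chars (p := p) (k := k) hpk
  exact not_budget_lt_of_char_translate hk (isCharacter_twChar (l := l) χ) (twChar_mem_levelSet χ)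
    (twChar_one_ne_zero χ) (c := 1)
    (D := (((p ^ (k * l) * p ^ (∑ i ∈ Finset.range k, i) : ℕ) : ℝ))) one_pos
    (by rw [classInner_twChar hχ hχ1, Complex.one_re]) (Nat.cast_nonneg _) (twChar_one_ge χ)
    (threshold_three hl) htpp x y hS hε

/-- The block slice itself (`x = y = 1`). -/
theorem no_slice_witness (hk : 1 ≤ k) (hl : 3 ≤ l) (hpk : k + 2 ≤ p)
    {H₁ H₂ H₃ : Subgroup (GLm p (k + l))} (htpp : SubgroupTPP H₁ H₂ H₃)
    (hS : ∀ a ∈ H₁, ∀ b ∈ H₂, ∀ c ∈ H₃, ∀ i j : Fin l,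
      ((a * b * c : GLm p (k + l)) : Mat p (k + l)) (Fin.natAdd k i) (Fin.natAdd k j) =
        (1 : Matrix (Fin l) (Fin l) (ZMod p)) i j)
    {ε : ℝ} (hε : 0 < ε) :
    ¬ ((∑ᶠ ψ ∈ irrChars (GLm p (k + l)) ∩ levelSet p (k + l) k, (ψ 1).re ^ (2 + ε)) <
        ((Nat.card H₁ * Nat.card H₂ * Nat.card H₃ : ℕ) : ℝ) ^ ((2 + ε) / 3)) :=
  no_translate_witness hk hl hpk htpp 1 1
    (fun a ha b hb c hc i j => by simpa using hS a ha b hb c hc i j) hε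

/-- **Ambient form**: for `m ≥ k + 3`, `k ≥ 1`, `p ≥ k + 2`, writing `m = k + l`, the block slice
`S_{m,k}` carries no witness of the crux inequality, for any `ε > 0`. -/
theorem no_slice_witness' {m : ℕ} (hk : 1 ≤ k) (hm : k + 3 ≤ m) (hpk : k + 2 ≤ p) :
    ∃ l, m = k + l ∧ ∀ {H₁ H₂ H₃ : Subgroup (GLm p (k + l))}, SubgroupTPP H₁ H₂ H₃ →
      (∀ a ∈ H₁, ∀ b ∈ H₂, ∀ c ∈ H₃, ∀ i j : Fin l,
        ((a * b * c : GLm p (k + l)) : Mat p (k + l)) (Fin.natAdd k i) (Fin.natAdd k j) =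
          (1 : Matrix (Fin l) (Fin l) (ZMod p)) i j) →
      ∀ {ε : ℝ}, 0 < ε →
        ¬ ((∑ᶠ ψ ∈ irrChars (GLm p (k + l)) ∩ levelSet p (k + l) k, (ψ 1).re ^ (2 + ε)) <
            ((Nat.card H₁ * Nat.card H₂ * Nat.card H₃ : ℕ) : ℝ) ^ ((2 + ε) / 3)) :=
  ⟨m - k, by omega, fun htpp hS _ hε => no_slice_witness hk (by omega) hpk htpp hS hε⟩

end FlagTwistNoGo
end Summit.MatrixMultiplication.MatrixMultiplication.Theorems.SubgroupIdentityDesigns.Negative
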